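import Summits.QuantumFields.YangMills.Theorems.LuscherReductionTwistedTraceScalingInnerBOPackage
import Summits.QuantumFields.YangMills.Theorems.TwistedTraceScaling.Negative.InnerPowWindow
import HarnessLib

/-!
# R18 (crux `TwistedTraceScaling`, stmt-QuantumFields-20203): lane A's typed C4 interface `InnerBOPackageAt L δ` (p599876) is EQUIVALENT to
# `InnerNoIntruderOneOrbitAt L δ` — the Feshbach package, as typed, is a costume of INNER one-orbit; its clauses carry no separate content

Standing disprover `ym-cdisprove-20203-1` (gen 16), sequel to `…Negative.InnerPowWindow` (R16) and `…Negative.ZpeKink` (R17).  Lane A (gen 11, design note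
COARSE-DESIGN §21) fixed the ARCHITECTURE of the C4 proof as the Prop `InnerBOPackageAt L δ` (∀ k ε>0 ∃ θ∈(0,1] ∃ β₀ ∀ β≥β₀ ∃ σ>0 ∃ b≥0 with `b² ≤ εθλ_b/16`,
FLOOR `e^{−ελ_b/4}σμ₀(L³β) ≤ λ₀(β,L)`, and for every admissible inner family `G` SOME split `Gᵢ = uᵢ + vᵢ` with ORTHOGONALITY, STIFF `⟨v_a,Kv_a⟩ ≤ (1−θ)σμ₀‖v_a‖²`,
OFF-DIAGONAL `⟨ψ_a,Kψ_a⟩ ≤ ⟨u_a,Ku_a⟩ + 2bσμ₀‖u_a‖‖v_a‖ + ⟨v_a,Kv_a⟩` and SLOW MIN–MAX `∃ a ≠ 0, ⟨u_a,Ku_a⟩ ≤ e^{ελ_b/4}σμ_k‖u_a‖²`) and proved ★★★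
`innerNoIntruderOneOrbitAt_of_package : InnerBOPackageAt L δ → InnerNoIntruderOneOrbitAt L δ` (`feshbach_endgame`); §21.6 names «the clauses of
`InnerBOPackageAt`» as the disprover's typed targets.  This file records, BY NAME:
* §1 ★★ `innerBOPackageAt_iff (δ) : InnerBOPackageAt L δ ↔ InnerNoIntruderOneOrbitAt L δ` (every `L ≥ 1`, every `δ`).  The converse
  `innerBOPackageAt_of_inner` is the TRIVIAL SPLIT `u = G`, `v = 0`, `θ = 1`, `b = 0`, `σ = e^{ελ_b/4}λ₀/μ₀` (FLOOR with equality; STIFF and OFF-DIAGONAL read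
  `0 ≤ 0`; SLOW MIN–MAX is INNER at `ε/2`).  So, AS TYPED, the data `θ, σ, b, u, v` are unconstrained existentials: none of the six clauses is a target — any
  proof of INNER instantiates all of them, and §21.6's questions («is a β-independent θ achievable?», «is the FLOOR at `e^{−ελ_b/4}` consistent with `Λ_id`?») have
  the answer «trivially, θ = 1 and σμ₀ = e^{ελ_b/4}λ₀» in the kernel.  The intended objects (fibrewise projection `P` onto `Ω₀`, Mehler gap `θ_S`, Gaussian value `σ`,
  first-order coupling `b`) live only in the untyped sub-targets G/K/Y/S/D/O/L/A of §21.5; C4 has not been cut into typed pieces yet (census: 0 typed bytes of C4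
  beyond INNER itself; bricks Y `…InnerSymmetry` p600559 and S `…MehlerGaussianFunctional` p601460 are unconditional linear algebra / Gaussian calculus — vetted,
  nothing to refute).
* §2 bookkeeping transported through §1: `innerBOPackageAt_anti` (a smaller box is easier, `R6.innerNoIntruderOneOrbitAt_anti`), and the door at the EDGE of the
  window — `coarseUpper_of_package_pow (hL : 2 ≤ L) (hp0 : 0 < p) (hp : p < 2/51)`, `coarseUpper_of_package_le` (any `δ ≥ powScale p`, some `p < 2/51`).  Lane A's
  `coarseNoIntruderAt_of_package_pow` carries the ten exponent hypotheses of the ★★★★★ door, hence (R16.innerPow_hypotheses_window / innerPow_door_shut_above) is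
  live EXACTLY on `0 < p < 2/51`; its docstring «any `p ∈ (0, 1/10)` in g10's window» repeats the record corrected in R16 (at `(17/20, 41/100, 11/200)`: `p < 11/400`).
READING for lane A / OWNER / LEAD twolattice (paper; the kernel part is §1–§2).  (i) The ∃-order `∃ σ b … ∀ G … ∃ u v` lets the split depend on the family but
forces `b` UNIFORM over all admissible families in the box `{orbitDist < δ(β)}`.  For the INTENDED split `u = Pψ` (§21.3/§21.5 A, O: `b = η ≍ β^{−1/4}·polylog`
«on the bulk `|c| ≲ β^{−1/4} log β`») this uniformity FAILS on the door's box: with `δ = β^{−p}`, `p < 2/51` (the only boxes the door consumes, R16), admissible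
families may live at constant-mode angle `|c|` anywhere up to `≍ β^{−p}/L³ ≫ β^{−1/4}`, and there the first-order slow–stiff coupling `βH₁(c)(q,q)` (§21.1 (N2);
zero MEAN by brick Y, but its `Ω₀ →` two-quanta matrix elements do not cancel) gives a cross term `|⟨Pψ, K(1−P)ψ⟩| ≍ L^{3/2}|c|·σμ₀‖u‖‖v‖`, i.e. `b(c) ≍ L^{3/2}|c|`,
and `b(c)² ≤ εθλ_b/16 ≍ εθ(L³β)^{−1/3}` holds only for `|c| ≲ c_ε := (εθ)^{1/2}L^{−2}β^{−1/6}`.  On the slow annulus `c_ε < |c| < β^{−p}/L³` (nonempty for every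
`p < 1/6`, eventually in β) the typed OFF-DIAGONAL clause is therefore NOT instantiated by `P` — only by a family-dependent split (e.g. the trivial one, which
throws the burden back on INNER there).  (ii) The transfer-matrix bulk of the slow sector is `|c| ≍ M·(L³β)^{−1/3}` (kinetic mass `L³β`, quartic `L³β|c×c|²`,
and along the toron valley the W-mode zero point `≍ |c|`: all balance at `(L³β)^{−1/3}`, the scale of `λ_b = (2/(L³β))^{1/3}`), not the classical single-slice
width `β^{−1/4}`; on that bulk every second-order quantity (`b²`, the stiff shift `κL³|c|²`, brick Y's `‖M‖_F²`) is `O(M²Lβ^{−2/3}) = o(λ_b)` with room.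
(iii) What §21.5 lacks is therefore a brick R — SLOW LOCALISATION / ANNULUS REPULSION: cut every admissible family at slow radius `R = M(L³β)^{−1/3}`
(partition of unity in `c`; min–max cost `≍ (L³β·R²)^{−1} = λ_b/(2^{1/3}M²)`, affordable for `M = M(k,ε)`), apply the package on `|c| ≤ 2R` (there `b ≍ L^{1/2}Mβ^{−1/3}`,
fine), and bound the sup-quotient on the annulus `R ≤ |c| < β^{−p}/L³` by `e^{−(Δ_k+ε)λ_b}σμ₀` using the ONE-SITE kernel's own transverse (W-mode) zero-point
repulsion `≍ g₁|c| ≥ g₁Mλ_b/2^{1/3}` (first order, exact inside `K₁^{L³β}` via `transferKernel_constLift`) against the second-order losses `(2b(c)²/θ + κL³|c|²) ≍ L³|c|²`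
— linear beats quadratic for `|c| ≤ θg₁/(CL³)`, i.e. on the whole shrinking box eventually; the stiff second-order shift has no definite sign (the primed
zero-point sum need not be convex at the vacuum) but is dominated the same way.  Brick R needs a one-site input of ONE's valley type («Ad-invariant `f` supported at
valley radius `≥ R ≫ B'^{−1/3}` has `⟨f,K₁f⟩ ≤ μ₀e^{−g₁'R}‖f‖²» at `B' = L³β`) and the fibrewise (c-dependent) Feshbach endgame; without it the assembly A cannot
discharge OFF-DIAGONAL with a uniform `b`, and a package proved on the reduced box alone does not feed the door (R16 §3: antitonicity runs the wrong way).
NO KILL: INNER one-orbit on `{orbitDist < β^{−p}}`, `p < 2/51`, remains plausible on paper (R16, §I of the work file); this file changes no verdict.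
HONEST FRAMING: a structural lemma about the typed interface of a stub lane (S-BASE C4) of a child of the CONDITIONAL reduction route (femto rung R2b1); not
`¬TwistedTraceScaling`, not infinite volume, not a gap, not Clay.  Sorry-free, no new definition; axioms ⊆ {propext, Classical.choice, Quot.sound}.

## References
* M. Lüscher, Nucl. Phys. B219 (1983) 233, §3 (Born–Oppenheimer reduction to the constant modes; the effective Hamiltonian's scale `g^{2/3}`). [Luscher1983]
* P. van Baal, J. Koller, Ann. Phys. 174 (1987) 299, §4 (the primed one-loop effective potential of the torons is second order). [VanbaalKoller1987]
* J. Sjöstrand, M. Zworski, Ann. Inst. Fourier 57 (2007) 2095, §2 (Schur complement / Feshbach map). [SjostrandZworski2007]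
-/

set_option autoImplicit false

noncomputable section

open MeasureTheory Filter Topology Real
open scoped BigOperators
open Literature.MathematicalPhysics.QuantumFieldTheory hiding SU2
open Literature.MathematicalPhysics.QuantumLattice
open Summit.QuantumFields.YangMills.Theorems.FemtoTransferGap

namespace Summit.QuantumFields.YangMills.Theorems.TwistedTraceScaling.Negative.R18

variable {L : ℕ} [NeZero L]

/-! ## §1 The package is INNER one-orbit -/

/-- The zero test function has zero mass. [folklore] -/
theorem l2_zero_fun : l2 (fun _ : GaugeConfig 3 L SU2 => (0 : ℝ)) (fun _ => (0 : ℝ)) = 0 := by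
  simp [l2]

/-- The zero test function has zero transfer form. [folklore] -/
theorem qform_zero_fun (β : ℝ) : qform su2Rep β (fun _ : GaugeConfig 3 L SU2 => (0 : ℝ)) (fun _ => (0 : ℝ)) = 0 := by
  simp [qform]

/-- ★ **INNER one-orbit ⇒ the BO package**, by the TRIVIAL SPLIT `u = G`, `v = 0`, `θ = 1`, `b = 0`, `σ = e^{ελ_b/4}λ₀/μ₀` (FLOOR with equality, STIFF and
OFF-DIAGONAL vacuous, SLOW MIN–MAX = INNER at `ε/2`): every `L ≥ 1`, every box `δ`. [cite: Luscher1983, §3] -/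
theorem innerBOPackageAt_of_inner {δ : ℝ → ℝ} (hI : InnerNoIntruderOneOrbitAt L δ) : InnerBOPackageAt L δ := by
  intro k ε hε
  obtain ⟨β0, hβ0⟩ := hI k (ε / 2) (half_pos hε)
  refine ⟨1, one_pos, le_rfl, max β0 1, fun β hβ => ?_⟩
  have hβ0' : β0 ≤ β := (le_max_left _ _).trans hβ
  have hβ1 : 1 ≤ β := (le_max_right _ _).trans hβ
  have hβpos : 0 < β := by linarith
  have hL0 : (0 : ℝ) < (L : ℝ) := by exact_mod_cast Nat.pos_of_ne_zero (NeZero.ne L)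
  have hB : 0 < (L : ℝ) ^ 3 * β := by positivity
  have hμ0 : 0 < levelValue su2Rep 1 ((L : ℝ) ^ 3 * β) 0 := levelValue_su2Rep_pos hB 0
  have hΛ0 : 0 < levelValue su2Rep L β 0 := levelValue_zero_su2Rep_pos L β
  have hlam0 : 0 < bareLambda ((L : ℝ) ^ 3 * β) := bareLambda_pos' hB
  set lam := bareLambda ((L : ℝ) ^ 3 * β) with hlam
  set μ0 := levelValue su2Rep 1 ((L : ℝ) ^ 3 * β) 0 with hμ0def
  set μk := levelValue su2Rep 1 ((L : ℝ) ^ 3 * β) k with hμkdef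
  set Λ0 := levelValue su2Rep L β 0 with hΛ0def
  refine ⟨Real.exp (ε / 4 * lam) * Λ0 / μ0, 0, by positivity, le_rfl, ?_, ?_, ?_⟩
  · -- `b² = 0 ≤ εθλ_b/16`
    have : (0 : ℝ) ^ 2 = 0 := by norm_num
    rw [this]; positivity
  · -- FLOOR with equality: `e^{−ελ/4}·(σμ₀) = λ₀`
    have hσμ : Real.exp (ε / 4 * lam) * Λ0 / μ0 * μ0 = Real.exp (ε / 4 * lam) * Λ0 := by
      field_simp
    rw [hσμ, ← mul_assoc, ← Real.exp_add, neg_add_cancel, Real.exp_zero, one_mul]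
  · intro G hGm hGb hGg hGs hGram
    refine ⟨G, fun _ _ => 0, fun a => ?_, ?_⟩
    · -- the trivial split: `u_a = ψ_a`, `v_a = 0`
      simp only [mul_zero, Finset.sum_const_zero, l2_zero_fun, qform_zero_fun, zero_mul, add_zero, sub_self]
      exact ⟨l2_self_nonneg_lat _, le_rfl, le_rfl, le_rfl, le_rfl⟩
    · -- SLOW MIN–MAX = INNER at `ε/2`
      obtain ⟨a, ha, hmain⟩ := hβ0 β hβ0' G hGm hGb hGg hGs hGram
      refine ⟨a, ha, ?_⟩
      have e2 : Real.exp (ε / 4 * lam) * (Real.exp (ε / 4 * lam) * Λ0 / μ0 * μk) = Real.exp (ε / 2 * lam) * μk * Λ0 / μ0 := by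
        rw [show ε / 2 * lam = ε / 4 * lam + ε / 4 * lam by ring, Real.exp_add]
        field_simp
      rw [e2, div_mul_eq_mul_div, le_div_iff₀ hμ0]
      exact hmain

/-- ★★ **The BO package is a costume of INNER one-orbit**: `InnerBOPackageAt L δ ↔ InnerNoIntruderOneOrbitAt L δ` (every `L ≥ 1`, every `δ`; ⟹ lane A's
`innerNoIntruderOneOrbitAt_of_package`, ⟸ the trivial split). [cite: Luscher1983, §3] [cite: SjostrandZworski2007, §2] -/
theorem innerBOPackageAt_iff (δ : ℝ → ℝ) : InnerBOPackageAt L δ ↔ InnerNoIntruderOneOrbitAt L δ :=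
  ⟨innerNoIntruderOneOrbitAt_of_package, innerBOPackageAt_of_inner⟩

/-! ## §2 Bookkeeping through the equivalence: the box is antitone, the door lives on `p < 2/51` -/

/-- The package is ANTITONE in the box radius (a smaller box is easier), as INNER is (`R6.innerNoIntruderOneOrbitAt_anti`). [cite: Luscher1983, §3] -/
theorem innerBOPackageAt_anti {δ δ' : ℝ → ℝ} (hle : ∀ β, δ' β ≤ δ β) (hP : InnerBOPackageAt L δ) : InnerBOPackageAt L δ' :=
  innerBOPackageAt_of_inner (R6.innerNoIntruderOneOrbitAt_anti hle (innerNoIntruderOneOrbitAt_of_package hP))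

/-- **COARSE-UPPER(L) ⇐ the package at ANY `p ∈ (0, 2/51)`** (`L ≥ 2`): lane A's `coarseNoIntruderAt_of_package_pow` with its ten exponent hypotheses eliminated
(they are satisfiable iff `p < 2/51`, `R16.innerPow_window_nonempty_iff`; the docstring's «any `p ∈ (0, 1/10)`» is immaterial on `[2/51, 1/10)`).
[cite: Luscher1983, §3] [cite: LuscherMunster1984, §2] -/
theorem coarseUpper_of_package_pow (hL : 2 ≤ L) {p : ℝ} (hp0 : 0 < p) (hp : p < 2 / 51) (hP : InnerBOPackageAt L (powScale p)) :
    ∀ k : ℕ, ∀ d : ℝ, d < levelGap k → ∃ lam0 : ℝ, 0 < lam0 ∧ ∀ lam : ℝ, 0 < lam → lam ≤ lam0 →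
      ∀ β : ℝ, InFemtoWindow lam β L →
        levelValue su2Rep L β k ≤ Real.exp (-(d * luscherLambda β L) / L) * levelValue su2Rep L β 0 :=
  R16.coarseUpper_of_inner_pow hL hp0 hp (innerNoIntruderOneOrbitAt_of_package hP)

/-- **Any box at least `β^{−p}` wide for some `p < 2/51` feeds the door through the package** (`L ≥ 2`); a package proved on a thinner box (e.g. the slow bulk
`M·L²β^{−1/3}` in `orbitDist` units, or `β^{−p}` with `p ≥ 2/51`) does NOT — antitonicity runs the wrong way (R16 §3). [cite: Luscher1983, §3] -/
theorem coarseUpper_of_package_le (hL : 2 ≤ L) {δ : ℝ → ℝ} (hδ : ∃ p : ℝ, 0 < p ∧ p < 2 / 51 ∧ ∀ β, powScale p β ≤ δ β)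
    (hP : InnerBOPackageAt L δ) :
    ∀ k : ℕ, ∀ d : ℝ, d < levelGap k → ∃ lam0 : ℝ, 0 < lam0 ∧ ∀ lam : ℝ, 0 < lam → lam ≤ lam0 →
      ∀ β : ℝ, InFemtoWindow lam β L →
        levelValue su2Rep L β k ≤ Real.exp (-(d * luscherLambda β L) / L) * levelValue su2Rep L β 0 :=
  R16.coarseUpper_of_inner_le hL hδ (innerNoIntruderOneOrbitAt_of_package hP)

/-- Sanity (the window of lane A's package door, by name): its exponent hypotheses force `p < 2/51`. [cite: Luscher1983, §3] -/
theorem package_pow_hypotheses_window {p q r m : ℝ} (hq : q < 8 / 9) (hrq : 2 * r < q - m / 2) (hpm : p < m / 2)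
    (hC : 1 + 3 * m - 3 * r < -p) : p < 2 / 51 :=
  (R16.innerPow_hypotheses_window hq hrq hpm hC).1

end Summit.QuantumFields.YangMills.Theorems.TwistedTraceScaling.Negative.R18

end
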